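import Summits.AtomisticToContinuum.Crystallization.Theorems.ExcessDecayLiouvillePhononStabilityDefs
import Summits.AtomisticToContinuum.Crystallization.Theorems.ExcessDecayLiouvillePhononStabilityLabels

/-!
# `PhononStability` (stmt-AtomisticToContinuum-9333), line `contragredient-window-collapse`: bonds of the pull-back

Per-bond input for the stub `stub_pullback` (reduction S1b, `PullbackReduction`, file
`ExcessDecayLiouvillePhononStabilityPullback.lean`) of the line: for a window cell `A` (`CellWindow A`), a shift
error `δ` (`ShiftWindow A δ`) and a contragredient `B` (`⟪Ax, By⟫ = ⟪x, y⟫`, i.e. `B = A⁻ᵀ`),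

* non-diagonal bond classes `c = (m, m', n)` have reference length `‖ζ⁰_c‖ ≥ 1` (intra-sublattice classes are
  nonzero lattice vectors, `‖latVec n‖² = n₀² + n₀n₁ + n₁² + (8/3)n₂² ≥ 1` over `ℤ`; inter-sublattice classes are
  `±(innerRef − latVec d)` and `dist(innerRef, Λ₀) = 1`), hence actual length
  `‖Aζ_c(δ)‖ ≥ 0.945(‖ζ⁰_c‖ − 5/189) ≥ (23/25)‖ζ⁰_c‖ ≥ 23/25`;
* the per-bond pull-back identity `Hess₀ (Aζ) (BΔ) = ω(‖Aζ‖)⟪ζ, Δ⟫² + ψ(‖Aζ‖)‖BΔ‖²` for `Aζ ≠ 0`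
  (`V″ = 13r⁻¹⁴ − 7r⁻⁸`, `V′ = −r⁻¹³ + r⁻⁷`, `⟪Aζ, BΔ⟫ = ⟪ζ, Δ⟫`);
* the bounds `|ω(‖Aζ_c‖)⟪ζ_c, Δ⟫² + ψ(‖Aζ_c‖)‖BΔ‖²| ≤ 10⁶‖ζ⁰_c‖⁻⁸‖Δ‖²` and
  `𝟙[‖Aζ_c‖ ≤ 11/10]‖BΔ‖² ≤ 20‖ζ⁰_c‖⁻⁸‖Δ‖²` on the pulled-back summands (from `‖ζ_c‖ ≤ 2‖Aζ_c‖`,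
  `‖BΔ‖ ≤ (200/189)‖Δ‖`, `‖Aζ_c‖⁻¹ ≤ 2‖ζ⁰_c‖⁻¹ ≤ 2`), which make them absolutely summable against the lattice sum
  `Σ_c ‖ζ⁰_c‖⁻⁸ Σ_k ‖Δ_c w k‖²`.

All `[folklore]`.
-/

noncomputable section

open scoped BigOperators Classical InnerProductSpace
open Filter Set Function
open Literature.MathematicalPhysics.StatisticalMechanics
open Summit.AtomisticToContinuum.Crystallization.Theses.ExcessDecayLiouville
open Summit.AtomisticToContinuum.Crystallization.Theorems.PhononStabilityNegative
open Summit.AtomisticToContinuum.Crystallization.Theorems.PhononStabilityCWC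

namespace Summit.AtomisticToContinuum.Crystallization.Theorems.PhononStabilityCWC.PullbackStub

/-! ## Elementary API (partly copies of the line's Basics file, which is not yet in the tree) -/

/-- `latVec (−n) = −latVec n`. [folklore] -/
private theorem latVec_neg (n : Fin 3 → ℤ) : latVec (-n) = -latVec n := by
  simp only [latVec, Pi.neg_apply, Int.cast_neg, neg_smul]
  abel

/-- `refPos δ (m, n) = latVec n + σ(m)·(innerRef + δ)`; copy of the line's Basics lemma. [folklore] -/
private theorem refPos_eq (δ : EuclideanSpace ℝ (Fin 3)) (ℓ : Label) :
    refPos δ ℓ = latVec ℓ.2 + subSign ℓ.1 • (innerRef + δ) := by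
  unfold refPos subSign
  split_ifs <;> simp

/-- `ζ_c(δ) = ζ⁰_c + (σ(m') − σ(m))·δ`; copy of the line's Basics lemma. [folklore] -/
private theorem bondVec_eq (δ : EuclideanSpace ℝ (Fin 3)) (c : BondClass) :
    bondVec δ c = bondVec 0 c + (subSign c.2.1 - subSign c.1) • δ := by
  simp only [bondVec, refPos_eq, smul_add, sub_smul, add_zero]
  abel

/-- `|σ(m') − σ(m)| ≤ 1`; copy of the line's Basics lemma. [folklore] -/
private theorem abs_subSign_sub_le (m m' : Fin 2) : |subSign m' - subSign m| ≤ 1 := by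
  unfold subSign
  split_ifs <;> norm_num

/-- `‖ζ_c(δ) − ζ⁰_c‖ ≤ ‖δ‖`; copy of the line's Basics lemma. [folklore] -/
private theorem norm_bondVec_sub_le (δ : EuclideanSpace ℝ (Fin 3)) (c : BondClass) :
    ‖bondVec δ c - bondVec 0 c‖ ≤ ‖δ‖ := by
  rw [bondVec_eq δ c, add_sub_cancel_left, norm_smul, Real.norm_eq_abs]
  calc |subSign c.2.1 - subSign c.1| * ‖δ‖ ≤ 1 * ‖δ‖ :=
        mul_le_mul_of_nonneg_right (abs_subSign_sub_le _ _) (norm_nonneg _)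
    _ = ‖δ‖ := one_mul _

/-- The diagonal class has zero displacement differences. [folklore] -/
private theorem bondDiff_diag (w : Label → EuclideanSpace ℝ (Fin 3)) (k : Fin 3 → ℤ) {c : BondClass}
    (hc : diagClass c) : bondDiff c w k = 0 := by
  obtain ⟨m, m', n⟩ := c
  obtain ⟨h1, h2⟩ := hc
  simp only at h1 h2
  subst h1; subst h2
  simp [bondDiff]

/-- Upper Gram bound of the contragredient, `‖By‖ ≤ (200/189)‖y‖` (the half of the line's Basics lemma
`metricBand_of_contragredient` used here: `‖By‖² = ⟪A⁻¹By, y⟫ ≤ ‖A⁻¹By‖‖y‖ ≤ (200/189)‖By‖‖y‖`). [folklore] -/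
private theorem norm_contragredient_le {A B : EuclideanSpace ℝ (Fin 3) →L[ℝ] EuclideanSpace ℝ (Fin 3)}
    (hW : CellWindow A) (hAB : Contragredient A B) (y : EuclideanSpace ℝ (Fin 3)) :
    ‖B y‖ ≤ 200 / 189 * ‖y‖ := by
  obtain ⟨Ai, -, hAi⟩ := LabelsStub.exists_inverse_of_cellWindow hW
  have h3 := (hW (Ai (B y))).1
  rw [hAi] at h3
  have h1 : ‖B y‖ ^ 2 ≤ 200 / 189 * ‖B y‖ * ‖y‖ := by
    calc ‖B y‖ ^ 2 = inner ℝ (Ai (B y)) y := by rw [← hAB, hAi, real_inner_self_eq_norm_sq]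
      _ ≤ ‖Ai (B y)‖ * ‖y‖ := real_inner_le_norm _ _
      _ ≤ 200 / 189 * ‖B y‖ * ‖y‖ := by gcongr; linarith
  nlinarith [norm_nonneg (B y), norm_nonneg y]

/-! ## Reference lengths: non-diagonal classes have `‖ζ⁰_c‖ ≥ 1` -/

/-- The integer core of `‖latVec n‖ ≥ 1`: `n₀² + n₀n₁ + n₁² + n₂² ≥ 1` for `n ≠ 0`
(`4(n₀² + n₀n₁ + n₁²) = (2n₀ + n₁)² + 3n₁²`). [folklore] -/
theorem one_le_intCore {n : Fin 3 → ℤ} (hn : n ≠ 0) :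
    (1 : ℤ) ≤ n 0 ^ 2 + n 0 * n 1 + n 1 ^ 2 + n 2 ^ 2 := by
  obtain ⟨i, hi⟩ := Function.ne_iff.mp hn
  fin_cases i
  · have hi' : n 0 ≠ 0 := hi
    have h : 0 < n 0 ^ 2 := by positivity
    nlinarith [sq_nonneg (n 0 + 2 * n 1), sq_nonneg (n 2)]
  · have hi' : n 1 ≠ 0 := hi
    have h : 0 < n 1 ^ 2 := by positivity
    nlinarith [sq_nonneg (2 * n 0 + n 1), sq_nonneg (n 2)]
  · have hi' : n 2 ≠ 0 := hi
    have h : 0 < n 2 ^ 2 := by positivity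
    nlinarith [sq_nonneg (2 * n 0 + n 1), sq_nonneg (n 1)]

/-- Nonzero lattice vectors are long: `‖latVec n‖ ≥ 1` for `n ≠ 0`
(`‖latVec n‖² = n₀² + n₀n₁ + n₁² + (8/3)n₂²` in triangular coordinates). [folklore] -/
theorem one_le_norm_latVec {n : Fin 3 → ℤ} (hn : n ≠ 0) : 1 ≤ ‖latVec n‖ := by
  obtain ⟨a0, a1, a2⟩ := LabelsStub.latVec_apply n
  have h3 : (√3 : ℝ) ^ 2 = 3 := Real.sq_sqrt (by norm_num)
  have h23 : (√(2 / 3) : ℝ) ^ 2 = 2 / 3 := Real.sq_sqrt (by norm_num)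
  have hsq : ‖latVec n‖ ^ 2 =
      ((n 0 : ℝ) ^ 2 + (n 0 : ℝ) * n 1 + (n 1 : ℝ) ^ 2) + 8 / 3 * (n 2 : ℝ) ^ 2 := by
    rw [EuclideanSpace.real_norm_sq_eq, Fin.sum_univ_three, a0, a1, a2]
    linear_combination ((n 1 : ℝ) / 2) ^ 2 * h3 + (2 * (n 2 : ℝ)) ^ 2 * h23
  have hcore : (1 : ℝ) ≤ (n 0 : ℝ) ^ 2 + (n 0 : ℝ) * n 1 + (n 1 : ℝ) ^ 2 + (n 2 : ℝ) ^ 2 := by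
    exact_mod_cast one_le_intCore hn
  have h1 : 1 ≤ ‖latVec n‖ ^ 2 := by rw [hsq]; nlinarith [sq_nonneg (n 2 : ℝ)]
  nlinarith [norm_nonneg (latVec n)]

/-- Reference bond vectors inside sublattice `0` are lattice vectors. [folklore] -/
private theorem bondVec_zero_inl (n : Fin 3 → ℤ) : bondVec 0 ((0 : Fin 2), (0 : Fin 2), n) = latVec n := by
  simp [bondVec, refPos, latVec]

/-- Reference bond vectors inside sublattice `1` are lattice vectors. [folklore] -/
private theorem bondVec_zero_inr (n : Fin 3 → ℤ) : bondVec 0 ((1 : Fin 2), (1 : Fin 2), n) = latVec n := by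
  simp [bondVec, refPos, latVec]

/-- Reference bond vectors from sublattice `0` to sublattice `1` are `innerRef − latVec(−n)`. [folklore] -/
private theorem bondVec_zero_up (n : Fin 3 → ℤ) :
    bondVec 0 ((0 : Fin 2), (1 : Fin 2), n) = innerRef - latVec (-n) := by
  rw [latVec_neg, sub_neg_eq_add, add_comm]
  simp [bondVec, refPos, latVec]

/-- Reference bond vectors from sublattice `1` to sublattice `0` are `latVec n − innerRef`. [folklore] -/
private theorem bondVec_zero_down (n : Fin 3 → ℤ) :
    bondVec 0 ((1 : Fin 2), (0 : Fin 2), n) = latVec n - innerRef := by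
  simp [bondVec, refPos, latVec]

/-- **Non-diagonal classes have reference length `‖ζ⁰_c‖ ≥ 1`:** intra-sublattice classes are nonzero lattice
vectors, inter-sublattice classes are `±(innerRef − latVec d)` with `dist(innerRef, Λ₀) ≥ 1`. [folklore] -/
theorem one_le_norm_bondVec_zero {c : BondClass} (hc : ¬ diagClass c) : 1 ≤ ‖bondVec 0 c‖ := by
  obtain ⟨m, m', n⟩ := c
  have hc' : m = m' → n ≠ 0 := fun h hn => hc ⟨h, hn⟩
  fin_cases m <;> fin_cases m' <;> simp only [Fin.zero_eta, Fin.mk_one, Fin.isValue] at hc' ⊢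
  · rw [bondVec_zero_inl]
    exact one_le_norm_latVec (by simpa using hc')
  · rw [bondVec_zero_up]
    exact LabelsStub.one_le_norm_innerRef_sub_latVec (-n)
  · rw [bondVec_zero_down, norm_sub_rev]
    exact LabelsStub.one_le_norm_innerRef_sub_latVec n
  · rw [bondVec_zero_inr]
    exact one_le_norm_latVec (by simpa using hc')

section Window

variable {A B : EuclideanSpace ℝ (Fin 3) →L[ℝ] EuclideanSpace ℝ (Fin 3)} {δ : EuclideanSpace ℝ (Fin 3)}

/-- **Actual bond lengths on the window:** for a non-diagonal class `‖Aζ_c(δ)‖ ≥ (23/25)‖ζ⁰_c‖ ≥ 23/25`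
(`‖Aζ‖ ≥ 0.945‖ζ‖`, `‖ζ − ζ⁰‖ ≤ ‖δ‖ ≤ 5/189`, `‖ζ⁰‖ ≥ 1`). [folklore] -/
theorem norm_map_bondVec_ge (hW : CellWindow A) (hδ : ShiftWindow A δ) {c : BondClass}
    (hc : ¬ diagClass c) :
    23 / 25 * ‖bondVec 0 c‖ ≤ ‖A (bondVec δ c)‖ ∧ 23 / 25 ≤ ‖A (bondVec δ c)‖ := by
  have h1 : 1 ≤ ‖bondVec 0 c‖ := one_le_norm_bondVec_zero hc
  have h2 : ‖bondVec δ c - bondVec 0 c‖ ≤ ‖δ‖ := norm_bondVec_sub_le δ c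
  have h3 : ‖δ‖ ≤ 5 / 189 := by
    have := (hW δ).1
    unfold ShiftWindow at hδ
    linarith
  have h4 : ‖bondVec 0 c‖ - ‖bondVec δ c - bondVec 0 c‖ ≤ ‖bondVec δ c‖ := by
    have := norm_sub_norm_le (bondVec 0 c) (bondVec 0 c - bondVec δ c)
    rwa [sub_sub_cancel, norm_sub_rev (bondVec 0 c)] at this
  have h5 := (hW (bondVec δ c)).1
  constructor <;> linarith

/-- Powers of the inverse actual length against the reference charge: for `r ≥ (23/25)z`, `z ≥ 1`,
`r⁻¹⁴ ≤ 2¹⁴ z⁻⁸` and `r⁻⁸ ≤ 2⁸ z⁻⁸`. [folklore] -/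
theorem inv_pow_le {r z : ℝ} (hz : 1 ≤ z) (hr : 23 / 25 * z ≤ r) :
    (r⁻¹) ^ 14 ≤ 2 ^ 14 * (z⁻¹) ^ 8 ∧ (r⁻¹) ^ 8 ≤ 2 ^ 8 * (z⁻¹) ^ 8 := by
  have hz0 : 0 < z := by linarith
  have hr0 : 0 < r := by linarith
  have hx0 : 0 ≤ z⁻¹ := by positivity
  have hx1 : z⁻¹ ≤ 1 := inv_le_one_of_one_le₀ hz
  have hy : r⁻¹ ≤ 2 * z⁻¹ := by
    rw [show (2 : ℝ) * z⁻¹ = (z / 2)⁻¹ by rw [inv_div]; ring]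
    exact inv_anti₀ (by positivity) (by linarith)
  have hy0 : 0 ≤ r⁻¹ := by positivity
  have h8 : (r⁻¹) ^ 8 ≤ (2 * z⁻¹) ^ 8 := pow_le_pow_left₀ hy0 hy 8
  have h14 : (r⁻¹) ^ 14 ≤ (2 * z⁻¹) ^ 14 := pow_le_pow_left₀ hy0 hy 14
  have hx6 : (z⁻¹) ^ 6 ≤ 1 := pow_le_one₀ hx0 hx1
  constructor
  · calc (r⁻¹) ^ 14 ≤ (2 * z⁻¹) ^ 14 := h14
      _ = 2 ^ 14 * (z⁻¹) ^ 8 * (z⁻¹) ^ 6 := by ring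
      _ ≤ 2 ^ 14 * (z⁻¹) ^ 8 * 1 := by gcongr
      _ = 2 ^ 14 * (z⁻¹) ^ 8 := by ring
  · calc (r⁻¹) ^ 8 ≤ (2 * z⁻¹) ^ 8 := h8
      _ = 2 ^ 8 * (z⁻¹) ^ 8 := by ring

/-! ## The per-bond pull-back identity and the bounds on the pulled-back summands -/

/-- **Per-bond pull-back identity:** for `B = A⁻ᵀ` and `Aζ ≠ 0`,
`Hess₀ (Aζ) (BΔ) = ω(‖Aζ‖)·⟪ζ, Δ⟫² + ψ(‖Aζ‖)·‖BΔ‖²` (`V″(r) = 13r⁻¹⁴ − 7r⁻⁸`, `V′(r)/r = −r⁻¹⁴ + r⁻⁸`,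
`⟪Aζ, BΔ⟫ = ⟪ζ, Δ⟫`). [folklore] -/
theorem Hess₀_pullback (hAB : Contragredient A B) (ζ Δ : EuclideanSpace ℝ (Fin 3)) (hζ : A ζ ≠ 0) :
    Hess₀ (A ζ) (B Δ) = omegaLJ ‖A ζ‖ * (inner ℝ ζ Δ) ^ 2 + psiLJ ‖A ζ‖ * ‖B Δ‖ ^ 2 := by
  have hr : ‖A ζ‖ ≠ 0 := norm_ne_zero_iff.mpr hζ
  simp only [Hess₀, omegaLJ, psiLJ, deriv_deriv_lennardJones hr, deriv_lennardJones hr, hAB ζ Δ,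
    div_eq_mul_inv]
  ring

/-- **Bound on the pulled-back second-variation summand:**
`|ω(‖Aζ_c‖)⟪ζ_c, Δ⟫² + ψ(‖Aζ_c‖)‖BΔ‖²| ≤ 10⁶·‖ζ⁰_c‖⁻⁸·‖Δ‖²` on the window (`‖ζ_c‖ ≤ 2‖Aζ_c‖`,
`‖BΔ‖ ≤ 2‖Δ‖`, `‖Aζ_c‖ ≥ (23/25)‖ζ⁰_c‖ ≥ 23/25`; everything vanishes on the diagonal class). [folklore] -/
theorem abs_classSummand_le (hW : CellWindow A) (hδ : ShiftWindow A δ) (hAB : Contragredient A B)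
    (w : Label → EuclideanSpace ℝ (Fin 3)) (c : BondClass) (k : Fin 3 → ℤ) :
    |omegaLJ ‖A (bondVec δ c)‖ * (inner ℝ (bondVec δ c) (bondDiff c w k)) ^ 2 +
        psiLJ ‖A (bondVec δ c)‖ * ‖B (bondDiff c w k)‖ ^ 2| ≤
      1000000 * (‖bondVec 0 c‖⁻¹) ^ 8 * ‖bondDiff c w k‖ ^ 2 := by
  by_cases hc : diagClass c
  · rw [bondDiff_diag w k hc]
    simp
  · obtain ⟨hr, hr1⟩ := norm_map_bondVec_ge hW hδ hc
    have hz : 1 ≤ ‖bondVec 0 c‖ := one_le_norm_bondVec_zero hc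
    have hζr : ‖bondVec δ c‖ ≤ 2 * ‖A (bondVec δ c)‖ := by
      have := (hW (bondVec δ c)).1
      linarith
    have hBΔ : ‖B (bondDiff c w k)‖ ≤ 2 * ‖bondDiff c w k‖ := by
      have := norm_contragredient_le hW hAB (bondDiff c w k)
      linarith [norm_nonneg (bondDiff c w k)]
    obtain ⟨h14, h8⟩ := inv_pow_le hz hr
    generalize bondVec δ c = ζ at *
    generalize bondDiff c w k = Δ at *
    generalize ‖bondVec 0 c‖ = z at *
    generalize hr_def : ‖A ζ‖ = r at *
    have hr0 : 0 < r := by linarith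
    have hy : r⁻¹ * r = 1 := inv_mul_cancel₀ hr0.ne'
    have hω : |omegaLJ r| ≤ 14 * (r⁻¹) ^ 16 + 8 * (r⁻¹) ^ 10 := by
      unfold omegaLJ
      have h16 : 0 ≤ (r⁻¹) ^ 16 := by positivity
      have h10 : 0 ≤ (r⁻¹) ^ 10 := by positivity
      exact abs_le.2 ⟨by linarith, by linarith⟩
    have hψ : |psiLJ r| ≤ (r⁻¹) ^ 14 + (r⁻¹) ^ 8 := by
      unfold psiLJ
      have h14' : 0 ≤ (r⁻¹) ^ 14 := by positivity
      have h8' : 0 ≤ (r⁻¹) ^ 8 := by positivity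
      exact abs_le.2 ⟨by linarith, by linarith⟩
    have hin : (inner ℝ ζ Δ) ^ 2 ≤ ‖ζ‖ ^ 2 * ‖Δ‖ ^ 2 := by
      have h := abs_real_inner_le_norm ζ Δ
      have h0 := abs_nonneg (inner ℝ ζ Δ)
      calc (inner ℝ ζ Δ) ^ 2 = |inner ℝ ζ Δ| ^ 2 := (sq_abs _).symm
        _ ≤ (‖ζ‖ * ‖Δ‖) ^ 2 := pow_le_pow_left₀ h0 h 2
        _ = ‖ζ‖ ^ 2 * ‖Δ‖ ^ 2 := by ring
    have h1 : |omegaLJ r| * (inner ℝ ζ Δ) ^ 2 ≤ (56 * (r⁻¹) ^ 14 + 32 * (r⁻¹) ^ 8) * ‖Δ‖ ^ 2 := by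
      calc |omegaLJ r| * (inner ℝ ζ Δ) ^ 2
          ≤ (14 * (r⁻¹) ^ 16 + 8 * (r⁻¹) ^ 10) * (‖ζ‖ ^ 2 * ‖Δ‖ ^ 2) := by gcongr
        _ ≤ (14 * (r⁻¹) ^ 16 + 8 * (r⁻¹) ^ 10) * ((2 * r) ^ 2 * ‖Δ‖ ^ 2) := by gcongr
        _ = (56 * (r⁻¹) ^ 14 + 32 * (r⁻¹) ^ 8) * ‖Δ‖ ^ 2 * (r⁻¹ * r) ^ 2 := by ring
        _ = (56 * (r⁻¹) ^ 14 + 32 * (r⁻¹) ^ 8) * ‖Δ‖ ^ 2 := by rw [hy]; ring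
    have h2 : |psiLJ r| * ‖B Δ‖ ^ 2 ≤ (4 * (r⁻¹) ^ 14 + 4 * (r⁻¹) ^ 8) * ‖Δ‖ ^ 2 := by
      calc |psiLJ r| * ‖B Δ‖ ^ 2 ≤ ((r⁻¹) ^ 14 + (r⁻¹) ^ 8) * (2 * ‖Δ‖) ^ 2 := by gcongr
        _ = (4 * (r⁻¹) ^ 14 + 4 * (r⁻¹) ^ 8) * ‖Δ‖ ^ 2 := by ring
    calc |omegaLJ r * (inner ℝ ζ Δ) ^ 2 + psiLJ r * ‖B Δ‖ ^ 2|
        ≤ |omegaLJ r * (inner ℝ ζ Δ) ^ 2| + |psiLJ r * ‖B Δ‖ ^ 2| := abs_add_le _ _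
      _ = |omegaLJ r| * (inner ℝ ζ Δ) ^ 2 + |psiLJ r| * ‖B Δ‖ ^ 2 := by
          rw [abs_mul, abs_mul, abs_of_nonneg (sq_nonneg (inner ℝ ζ Δ)), abs_of_nonneg (sq_nonneg ‖B Δ‖)]
      _ ≤ (56 * (r⁻¹) ^ 14 + 32 * (r⁻¹) ^ 8) * ‖Δ‖ ^ 2 + (4 * (r⁻¹) ^ 14 + 4 * (r⁻¹) ^ 8) * ‖Δ‖ ^ 2 :=
          add_le_add h1 h2
      _ = (60 * (r⁻¹) ^ 14 + 36 * (r⁻¹) ^ 8) * ‖Δ‖ ^ 2 := by ring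
      _ ≤ (60 * (2 ^ 14 * (z⁻¹) ^ 8) + 36 * (2 ^ 8 * (z⁻¹) ^ 8)) * ‖Δ‖ ^ 2 := by gcongr
      _ = 992256 * (z⁻¹) ^ 8 * ‖Δ‖ ^ 2 := by ring
      _ ≤ 1000000 * (z⁻¹) ^ 8 * ‖Δ‖ ^ 2 := by gcongr; norm_num

/-- **Bound on the pulled-back nearest-neighbour summand:** `𝟙[‖Aζ_c‖ ≤ 11/10]·‖BΔ‖² ≤ 20·‖ζ⁰_c‖⁻⁸·‖Δ‖²`
(on the indicator set `‖ζ⁰_c‖ ≤ 6/5`, so `‖ζ⁰_c‖⁻⁸ ≥ (5/6)⁸ > 1/5`; `‖BΔ‖ ≤ 2‖Δ‖`). [folklore] -/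
theorem abs_nnSummand_le (hW : CellWindow A) (hδ : ShiftWindow A δ) (hAB : Contragredient A B)
    (w : Label → EuclideanSpace ℝ (Fin 3)) (c : BondClass) (k : Fin 3 → ℤ) :
    |(if ‖A (bondVec δ c)‖ ≤ 11 / 10 then ‖B (bondDiff c w k)‖ ^ 2 else 0)| ≤
      20 * (‖bondVec 0 c‖⁻¹) ^ 8 * ‖bondDiff c w k‖ ^ 2 := by
  split_ifs with h
  · by_cases hc : diagClass c
    · rw [bondDiff_diag w k hc]
      simp
    · obtain ⟨hr, -⟩ := norm_map_bondVec_ge hW hδ hc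
      have hz : 1 ≤ ‖bondVec 0 c‖ := one_le_norm_bondVec_zero hc
      have hz' : ‖bondVec 0 c‖ ≤ 6 / 5 := by linarith
      have hx : 5 / 6 ≤ ‖bondVec 0 c‖⁻¹ := by
        rw [show (5 / 6 : ℝ) = (6 / 5)⁻¹ by norm_num]
        exact inv_anti₀ (by linarith) hz'
      have hB : ‖B (bondDiff c w k)‖ ≤ 2 * ‖bondDiff c w k‖ := by
        have := norm_contragredient_le hW hAB (bondDiff c w k)
        linarith [norm_nonneg (bondDiff c w k)]
      rw [abs_of_nonneg (by positivity)]
      calc ‖B (bondDiff c w k)‖ ^ 2 ≤ (2 * ‖bondDiff c w k‖) ^ 2 := by gcongr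
        _ = 4 * 1 * ‖bondDiff c w k‖ ^ 2 := by ring
        _ ≤ 4 * (5 * (‖bondVec 0 c‖⁻¹) ^ 8) * ‖bondDiff c w k‖ ^ 2 := by
            gcongr
            calc (1 : ℝ) ≤ 5 * (5 / 6 : ℝ) ^ 8 := by norm_num
              _ ≤ 5 * (‖bondVec 0 c‖⁻¹) ^ 8 := by gcongr
        _ = 20 * (‖bondVec 0 c‖⁻¹) ^ 8 * ‖bondDiff c w k‖ ^ 2 := by ring
  · rw [abs_zero]
    positivity

end Window

/-! ## Anchor -/

/-- Registered anchor sub-goal of the line (`stub_pullbackBonds`): the per-bond pull-back identity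
`Hess₀ (Aζ) (BΔ) = ω(‖Aζ‖)⟪ζ, Δ⟫² + ψ(‖Aζ‖)‖BΔ‖²` for a contragredient pair and `Aζ ≠ 0`; its landing puts the
per-bond lemmas of `stub_pullback` in the tree. [folklore] -/
theorem stub_pullbackBonds : ∀ A B : EuclideanSpace ℝ (Fin 3) →L[ℝ] EuclideanSpace ℝ (Fin 3), Contragredient A B → ∀ ζ Δ : EuclideanSpace ℝ (Fin 3), A ζ ≠ 0 → Hess₀ (A ζ) (B Δ) = omegaLJ ‖A ζ‖ * (inner ℝ ζ Δ) ^ 2 + psiLJ ‖A ζ‖ * ‖B Δ‖ ^ 2 :=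
  fun _ _ hAB ζ Δ hζ => Hess₀_pullback hAB ζ Δ hζ

end Summit.AtomisticToContinuum.Crystallization.Theorems.PhononStabilityCWC.PullbackStub

end
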